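import Literature.MathematicalPhysics.QuantumFieldTheory.Balaban1983to89.Node00.Record8
import Literature.MathematicalPhysics.QuantumFieldTheory.Balaban1983to89.Node00.BackgroundActionT
import Literature.MathematicalPhysics.QuantumFieldTheory.Balaban1983to89.B12NodeKnit

/-!
# NODE N09 · [Balaban1987RG1] AT THE STAGE-8 RECORD — the Theorem-3 member `smallCouplings → smallFieldInductive` of `Dag.B12_main`
# KNIT BY NAME at `Node00.IsRecordOfRecord₈C`, and N09 at the record REDUCED to its own leaf `b12` (the B12-group pin)

T. Bałaban, *Renormalization group approach to lattice gauge field theories. I*, Commun. Math. Phys. **109** (1987) 249–301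
[Balaban1987RG1] (= [I]; PDF page = journal page − 248); [Balaban1985Variational] (= [B11], CMP 102) Thm 1 p. 279.  TRACK A
(YM-PLAN §2b, node N09 of 28), seat `pub-ymgap-dag-n09-a` (prover, KNIT-BY-NAME; HUMAN RULING D-0062).  THEOREMS ONLY, def-free,
sorry-free, standard axioms.  Successor module of `B12NodeKnit` (v1–v6): there the node was knit at a run whose carrier bundle is
bound by an explicit hypothesis `hP : w.up P = …` and whose construction `w.C` was FREE (NODE 00 Stages ≤ 3); here the construction
IS NODE 00's construction of record at Stage 8 (`Node00.Record8`, seat node00-def: `IndAss := Node00.IndAOfRecord`, the FORMAT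
predicate «(1.1) ∧ (1.3)∕(0.22)–(0.23)» of [I] pp. 256, 260 — dedicated definer node00-def-B's `Node00.BackgroundActionOfRecord`,
divergence D-defB-2: the estimates (1.8)–(1.19) are displayed elsewhere, not conjuncts of `IndA`).

## THE NODE AND ITS THEOREM-3 MEMBER AT THE RECORD

  `B12_main ℓ := ℓ.b4 → … → ℓ.b11 → (ℓ.b12 ∧ (ℓ.b12 → ℓ.b13 → (ℓ.smallCouplings → ℓ.smallFieldInductive)))`,

`ℓ := DagBinding.leavesP w P`; `smallCouplings = (w.C P).flow.InInterval w.γ P.K`, `smallFieldInductive = ∀ k ≤ P.K, (w.C P).IndAss k`.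
At a Stage-8 record `Node00.IsRecordOfRecord₈C F N D w` (`w.C = D.C = (datumOfRecord₅ (θ.toStage5)).C` for admissible `θ : Stage8Params F N`
with `0 < w.γ ≤ θ.γ`): `(w.C P).IndAss k ↔ IndAOfRecord F N (chi7 θ) θ.εbg (betaOfRecord₈ θ) P k (prefixOf (genSeq (betaOfRecord₈ θ) P.g₀) k)
(domAltOfRecord θ.ν P.K k) (A_k) (A^η(U_k ·)) (𝐄_k)` (`Node00.indAss_stage8_iff`, `Iff.rfl`), and node00-def-B's `Node00.indAOfRecord_atRecord`
(module `Node00.BackgroundActionT`) PROVES that right-hand side from four located inputs: (a) χ-locality in the couplings; (b) the flow recursion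
`FlowStep.RGEqH k β (genSeq β g₀)` ((0.20) in history form); (c) (1.1) on the domain — `UkExists ∧ UniqueUkOrbit` ([B11] Thm 1, N07's
content at the record's objects; cell GAPS G₈a-1∕-2); (d) `HCompT` — the composition of minimisers seen by the actions (⇐ `HOrbit` + the
residual-gauge invariance of `A_j ∘ Ū^j`, [I] (0.21) p. 256 ∕ (2.16) p. 269; `HOrbit` ⇐ `HRestrict` ([B11] Thm 1 (8)–(10)) + (1.1)-uniqueness at
the intermediate levels: `hOrbit_of_hRestrict_of_unique`, `hCompT_of_hOrbit_of_hInvT`).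

## WHAT THIS FILE PROVES (0 sorry; axioms {propext, Classical.choice, Quot.sound})

* §1 FLOW SIDE — input (b) DERIVED, not assumed: along every run of the assembled construction of a Stage-5 parameter that stays in some `]0, γ]`
  up to `K`, `RGEqH k βfun (genSeq βfun g₀)` for every `k ≤ K` (`rgEqH_datumOfRecord₅_of_inInterval`: `T4DatumAssembly.RGMachine.forwardGenerated ∕
  haltsOutside ∕ curries` + `FlowStepRuns.rgEqH_of_inInterval` + horizon monotonicity `rgEqH_of_le`); input (a) DISCHARGED: the characteristic functions
  of record `chi7 θ K g k = chiOfRecord θ.ν g K k` read the couplings only through `g k` (`chi7_extd_prefixOf`, by `chi_extd_prefixOf_of_pointwise` and `rfl`).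
* §2 THE CLAUSE `IndAss k` OF THE STAGE-8 CONSTRUCTION from (c) + (d) (+ the derived (b)): `indAss_stage8_of_hCompT`; and from (c) + `HRestrict` +
  intermediate uniqueness + the residual-gauge invariance of `A_j ∘ Ū^j` AT THE ORBIT POINTS `u · U_k(V)`, `V` in the domain (the domain-restricted
  form dag-ref-D's READ #39 nit N-defBT-1 asks consumers to use; displayed INLINE, no new definition): `indAss_stage8_of_hRestrict`.
* §3 THE THEOREM-3 MEMBER at `(w, P)` for any world bound to the Stage-8 construction (`w.C = (datumOfRecord₅ (θ.toStage5)).C`; ANY `w.γ`):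
  `thm3Member_stage8_of_hCompT` ∕ `thm3Member_stage8_of_hRestrict` — hypotheses per step `k ≤ P.K` at the run's objects; and N09 at `(w, P)` from them
  PLUS the run's own leaf `b12` (`b12_main_stage8_of_leaf_of_hCompT`), resp. N09 ⇔ «in-edges → `b12`» (`b12_main_stage8_iff_leaf_of_hCompT`).
* §4 AT THE RECORD PREDICATE `IsRecordOfRecord₈C F N D w` (θ hidden): the same with the hypotheses quantified over the record's parameters
  («every admissible `θ` presenting `D` and binding `w`», the pattern of `Node00.N24_at_record₈C_of_betaOfRecord₈`): `thm3Member_at_record₈C_of_hCompT` ∕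
  `_of_hRestrict`; **`b12_main_at_record₈C_iff_leaf`**: at every Stage-8 record, GIVEN (c)(d) over its parameters, `Dag.B12_main (leavesP w P)` ↔
  «`b4 → … → b11 → b12`» — N09 at the record IS ITS OWN LEAF; and the leaf unfolded: `b12_leaf_at_record₈C_iff` — `(leavesP w P).b12 ↔
  B12Sec2to5.Lemma4Printed (θ.res.X P).F12 (θ.res.X P).c12` over the record's FREE run-indexed carrier family `θ.res.X` (`Residual₅.X`) — so
  conjunct 1 is exactly the B12-GROUP PIN of NODE 00 (seat dag-n09-a's `N09-PIN-LIST.md`; `B12NodeKnit.b12_leaf_update` once pinned).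
* §5 THE DISCHARGE SHAPE UNDER THE PIN (R422, θ explicit): if the record's parameter pins the B12 frame of the run to a concrete Lemma-4 frame
  (`(θ.res.X P).F12 = B12Lemma4ConcreteFrame.frameOf 𝓜 (θ.res.X P).c12 D'`), N09 at `(w, P)` OUTRIGHT from (c)(d): `b12_main_stage8_of_frameOf_of_hCompT`
  (Lemma 4 (3.53) p. 280 by `B12NodeKnit.b12_leaf_of_frameOf`).
* §6 WHICH CLAUSES OF (d) CARRY CONTENT, AND THE FIRST STEPS: the top clause `j = k − 1` of `HCompT` is automatic (`iter_Uk`), the bottom clause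
  `j = 0` is `HOrbit`'s bottom clause + gauge invariance of the Wilson action `A_0 = −(1/g_0²)A^η` (`B12GaugeOrbits021.wilsonAction4_eq_of_orbitRel`)
  — so an invariance property of the EFFECTIVE actions `A_j`, `j ≥ 1`, is read only by the middle clauses `1 ≤ j ≤ k − 2` (`hCompT_of_middle`,
  `thm3Member_stage8_of_middle`); (1.1) at level `0` is membership in the regularity class and its uniqueness half holds outright
  (`ukExists_zero_iff`, `uniqueUkOrbit_zero`), hence **`indAss_stage8_zero`**: `IndAss 0` at every run of the Stage-8 construction is a THEOREM
  modulo the numeric window `θ.ν.ε₀ ≤ θ.εbg`; `indAss_stage8_one` ∕ `indAss_stage8_two`: the steps `k = 1, 2` from (1.1) at levels 1, 2 (+ `HOrbit`'s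
  bottom clause at 2) and the flow recursion — no invariance input (kernel form of `Node00.BackgroundActionT`'s remark «for k ≤ 2 no `HInvT` is needed»).
v1.1 (append-only; v1 declarations byte-identical): §7 — runs with `K ≤ 2`: `thm3Member_stage8_of_K_le_two` ∕ `thm3Member_at_record₈C_of_K_le_two` — the
  member at the Stage-8 construction ∕ record from the level-0 window, (1.1) at levels `1 ≤ k ≤ K` and `HOrbit`'s bottom clause at level 2: for short runs
  N09's Theorem-3 member at Stage 8 reads [B11] Thm 1 at the record's objects and nothing else.

WHAT IS DISPLAYED, BY NAME, AND WHOSE IT IS: (c) `Node00.UkExists ∕ UniqueUkOrbit` on `Node00.domAltOfRecord` and `Node00.HRestrict` — [B11] Thm 1 at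
the record's objects (node N07 at the record; GAPS G₈a-1∕-2; the admissibility window `B₃ε₁ ≤ ε₀ ≤ a₀` of [B11] is node00-def's numeric); (d) `Node00.HCompT`
∕ the orbit-point invariance of `A_j ∘ Ū^j` — [I] (0.21) p. 256, (2.16) p. 269 (over the RN-version transport `Node00.TOfRecord` of Stage 5 these are
POINT VALUES of a chosen version — typing note [DAGN09A-G2-HINV-TYPING-NOTE]; `Node00.BackgroundActionT` states them for a generic transport `T`, and
Stage 8 reads `T := TOfRecord`).  NOT displayed: (a), (b) (theorems here); the in-edges `b4 … b11`, `b13` are NOT consumed by the Theorem-3 member at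
Stage 8 — the kernel-checked consequence of D-defB-2 (`IndA` = format only): [I] Sects. 2–5 and [II] enter N09 at the record only through
conjunct 1 and through the estimate clauses a later NODE 00 stage may conjoin to `IndA` (then `B12NodeKnit` §3∕§6–§9 is the shape).
HONEST FRAMING: count-neutral kernel bookkeeping over landed theorems BY NAME; nothing of Bałaban's asserted; no estimate; conjunct 1 stays the
B12-group pin (node00-def's); [I] Theorem 2 (NODE O, n25) untouched; one finite four-torus programme at fixed ε per run — NOT ℝ⁴, NOT infinite
volume, NOT OS axioms, NOT a mass gap, NOT the Clay problem.
-/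

noncomputable section

namespace Literature.MathematicalPhysics.QuantumFieldTheory.Balaban1983to89.B12NodeKnitRecord8

open DagBinding Node00 T4Continuum T4DatumAssembly
open FlowStep (HBeta prefixOf RGEqH)
open FlowStepRuns (genSeq genFlow)
open T4FlagMemory (extd)
open B12RegularSpaces111 (Model)
open B12Lemma4ConcreteFrame (Lemma4Data frameOf)

variable (F : T4Family) (N : ℕ) [NeZero N]

/-! ## §1. Flow side and χ side: inputs (b) and (a) of `indAOfRecord_atRecord` at the Stage-5∕8 construction -/

omit [NeZero N] in
/-- The history recursion (0.20) up to horizon `K` restricts to every shorter horizon `k ≤ K`. [cite: Balaban1987RG1, (0.20) p.256 (bookkeeping)] -/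
theorem rgEqH_of_le {K k : ℕ} {β : HBeta} {g : ℕ → ℝ} (h : RGEqH K β g) (hk : k ≤ K) : RGEqH k β g :=
  fun j hj => h j (lt_of_lt_of_le hj hk)

/-- **(0.20) IN HISTORY FORM ALONG IN-INTERVAL RUNS OF THE ASSEMBLED CONSTRUCTION** (input (b), DERIVED): at a Stage-5 parameter `θ₅`, if the run
`p` of the construction of the assembled datum `datumOfRecord₅ θ₅` stays in `]0, γ]` up to `K`, then `1/g_j² = 1/g_{j+1}² + β_{j+1}(g_0,…,g_j)` for
all `j < k`, every `k ≤ K`, along the forward-generated couplings `genSeq θ₅.res.βfun p.g₀` — `FlowStepRuns.rgEqH_of_inInterval` fed with the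
assembler's three modelling clauses (`RGMachine.forwardGenerated ∕ haltsOutside ∕ curries`). [cite: Balaban1987RG1, (0.18)–(0.20) pp.255–256] -/
theorem rgEqH_datumOfRecord₅_of_inInterval (θ₅ : Stage5Params F N) (p : B12.RunParams) {γ : ℝ}
    (hI : ((datumOfRecord₅ F N θ₅).C p).flow.InInterval γ p.K) {k : ℕ} (hk : k ≤ p.K) :
    RGEqH k θ₅.res.βfun (genSeq θ₅.res.βfun p.g0) :=
  rgEqH_of_le
    (FlowStepRuns.rgEqH_of_inInterval ((machineOfRecord₅ F N θ₅).forwardGenerated (avOfRecord F N))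
      ((machineOfRecord₅ F N θ₅).haltsOutside (avOfRecord F N)) ((machineOfRecord₅ F N θ₅).curries (avOfRecord F N)) p hI)
    hk

/-- The same at a Stage-8 parameter, where the β-functions ARE `betaOfRecord₈ θ` (`Node00.βfun_stage8`, `rfl`). [cite: Balaban1987RG1, (0.20) p.256 and (1.20)–(1.22) p.264 (bookkeeping)] -/
theorem rgEqH_stage8_of_inInterval (θ : Stage8Params F N) (p : B12.RunParams) {γ : ℝ}
    (hI : ((datumOfRecord₅ F N (θ.toStage5 F N)).C p).flow.InInterval γ p.K) {k : ℕ} (hk : k ≤ p.K) :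
    RGEqH k (betaOfRecord₈ F N θ) (genSeq (betaOfRecord₈ F N θ) p.g0) :=
  rgEqH_datumOfRecord₅_of_inInterval F N (θ.toStage5 F N) p hI hk

/-- **χ-LOCALITY OF THE CHARACTERISTIC FUNCTIONS OF RECORD** (input (a), DISCHARGED): `chi7 θ K g k = chiOfRecord θ.ν g K k` reads the coupling
sequence only through `g k` (cube side `L^{k+1}M₂R_k(g_k)`, threshold `ε_k = g_k p₀(g_k)`), so the clamped history `extd (prefixOf g k)` and the run
`g` give the same `χ_n`, `n ≤ k` (`Node00.chi_extd_prefixOf_of_pointwise`, pointwise clause by `rfl`). [cite: Balaban1988Convergent, (2.17) p.257] -/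
theorem chi7_extd_prefixOf (θ : Stage8Params F N) (K k : ℕ) (g : ℕ → ℝ) :
    ∀ n ≤ k, chi7 F N θ K (extd (prefixOf g k)) n = chi7 F N θ K g n :=
  chi_extd_prefixOf_of_pointwise (chi7 F N θ) (fun _ _ _ => rfl) K k g

/-! ## §2. The clause `IndAss k` of the Stage-8 construction from the located [B11]-side inputs -/

/-- **`IndAss k` AT THE STAGE-8 CONSTRUCTION from (1.1) on the domain, `HCompT` and the flow recursion** — `Node00.indAss_stage8_iff` ∘
`Node00.indAOfRecord_atRecord`, χ-locality supplied by `chi7_extd_prefixOf`. Displayed: `h11` = [B11] Thm 1 at the record's level-`k` domain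
(`UkExists ∧ UniqueUkOrbit`); `hcomp` = the composition of minimisers seen by the actions ((0.23)'s bookkeeping input). [cite: Balaban1987RG1, (1.1)–(1.3) p.260 and (0.22)–(0.23) p.256] -/
theorem indAss_stage8_of_hCompT (θ : Stage8Params F N) (p : B12.RunParams) (k : ℕ)
    (hflow : RGEqH k (betaOfRecord₈ F N θ) (genSeq (betaOfRecord₈ F N θ) p.g0))
    (h11 : ∀ V ∈ domAltOfRecord F N θ.ν p.K k, UkExists F N p.K k θ.εbg V ∧ UniqueUkOrbit F N p.K k θ.εbg V)
    (hcomp : HCompT F N (TOfRecord F N) (chi7 F N θ) θ.εbg p.K (genSeq (betaOfRecord₈ F N θ) p.g0) k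
      (domAltOfRecord F N θ.ν p.K k)) :
    ((datumOfRecord₅ F N (θ.toStage5 F N)).C p).IndAss k :=
  (indAss_stage8_iff F N θ p k).2
    (indAOfRecord_atRecord F N (chi7 F N θ) θ.εbg (betaOfRecord₈ F N θ) p k (domAltOfRecord F N θ.ν p.K k)
      (chi7_extd_prefixOf F N θ p.K k _) hflow h11 hcomp)

/-- **`IndAss k` AT THE STAGE-8 CONSTRUCTION from (1.1) at level `k`, `HRestrict`, (1.1)-uniqueness at the intermediate levels and the
residual-gauge invariance of `A_j ∘ Ū^j` AT THE ORBIT POINTS** `u · U_k(V)` (`u` residual of level `j+1`, `V` in the domain, `j < k`) — the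
domain-restricted invariance, displayed inline: `HOrbit` by `Node00.hOrbit_of_hRestrict_of_unique`, then `HCompT` as in `Node00.hCompT_of_hOrbit_of_hInvT`
but reading the invariance only where it is used. [cite: Balaban1987RG1, (0.21) p.256, (1.1) p.260 and (2.16) p.269; Balaban1985Variational, Thm 1 (8)–(10) p.279] -/
theorem indAss_stage8_of_hRestrict (θ : Stage8Params F N) (p : B12.RunParams) (k : ℕ)
    (hflow : RGEqH k (betaOfRecord₈ F N θ) (genSeq (betaOfRecord₈ F N θ) p.g0))
    (h11 : ∀ V ∈ domAltOfRecord F N θ.ν p.K k, UkExists F N p.K k θ.εbg V ∧ UniqueUkOrbit F N p.K k θ.εbg V)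
    (hres : HRestrict F N θ.εbg p.K k (domAltOfRecord F N θ.ν p.K k))
    (huniq : ∀ V ∈ domAltOfRecord F N θ.ν p.K k, ∀ j < k,
      UniqueUkOrbit F N p.K (j + 1) θ.εbg (Averaging.iter (avOfRecord F N p.K) (j + 1) (Uk F N p.K k θ.εbg V)))
    (hinv : ∀ V ∈ domAltOfRecord F N θ.ν p.K k, ∀ j < k, ∀ u : GaugeTransf (F.P p.K) 0 (SU N),
      B12GaugeOrbits021.IsResidual (j + 1) u →
        effActionH F N (chi7 F N θ) p.K (genSeq (betaOfRecord₈ F N θ) p.g0) j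
            (Averaging.iter (avOfRecord F N p.K) j (GaugeField.gaugeAct u (Uk F N p.K k θ.εbg V))) =
          effActionH F N (chi7 F N θ) p.K (genSeq (betaOfRecord₈ F N θ) p.g0) j
            (Averaging.iter (avOfRecord F N p.K) j (Uk F N p.K k θ.εbg V))) :
    ((datumOfRecord₅ F N (θ.toStage5 F N)).C p).IndAss k := by
  refine indAss_stage8_of_hCompT F N θ p k hflow h11 ?_
  have hO := hOrbit_of_hRestrict_of_unique F N hres huniq
  intro V hV j hj
  obtain ⟨u, hu, hEq⟩ := hO V hV j hj
  rw [hEq]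
  exact hinv V hV j hj u hu

/-! ## §3. The Theorem-3 member and N09 at `(w, P)` for a world bound to the Stage-8 construction -/

section Stage8

variable {F N}
variable (θ : Stage8Params F N) {w : WorldP} (hC : w.C = (datumOfRecord₅ F N (θ.toStage5 F N)).C) (P : B12.RunParams)

include hC in
/-- **THE THEOREM-3 MEMBER OF N09 AT `(w, P)` FOR A WORLD BOUND TO THE STAGE-8 CONSTRUCTION, from per-step clauses along in-interval histories**:
if `IndAss k` holds at every `k ≤ K` whenever the flow recursion holds up to `k`, then `smallCouplings → smallFieldInductive` — the recursion being a
theorem along in-interval runs (§1). Any interval constant `w.γ`. [cite: Balaban1987RG1, Thm 1 p.259 and Thm 3 p.264] -/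
theorem thm3Member_stage8_of_steps
    (hind : ∀ k, k ≤ P.K → RGEqH k (betaOfRecord₈ F N θ) (genSeq (betaOfRecord₈ F N θ) P.g0) →
      ((datumOfRecord₅ F N (θ.toStage5 F N)).C P).IndAss k) :
    (leavesP w P).smallCouplings → (leavesP w P).smallFieldInductive := by
  intro hsc k hk
  have hsc' : (w.C P).flow.InInterval w.γ P.K := hsc
  show (w.C P).IndAss k
  rw [hC] at hsc' ⊢
  exact hind k hk (rgEqH_stage8_of_inInterval F N θ P hsc' hk)

include hC in
/-- **THE THEOREM-3 MEMBER AT `(w, P)`, Stage-8 construction, from (1.1) on the domains and `HCompT`, per step `k ≤ K`.**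
[cite: Balaban1987RG1, Thm 3 p.264, (1.1)–(1.3) p.260 and (0.22)–(0.23) p.256] -/
theorem thm3Member_stage8_of_hCompT
    (h11 : ∀ k, k ≤ P.K → ∀ V ∈ domAltOfRecord F N θ.ν P.K k, UkExists F N P.K k θ.εbg V ∧ UniqueUkOrbit F N P.K k θ.εbg V)
    (hcomp : ∀ k, k ≤ P.K → HCompT F N (TOfRecord F N) (chi7 F N θ) θ.εbg P.K (genSeq (betaOfRecord₈ F N θ) P.g0) k
      (domAltOfRecord F N θ.ν P.K k)) :
    (leavesP w P).smallCouplings → (leavesP w P).smallFieldInductive :=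
  thm3Member_stage8_of_steps θ hC P fun k hk hflow => indAss_stage8_of_hCompT F N θ P k hflow (h11 k hk) (hcomp k hk)

include hC in
/-- **THE THEOREM-3 MEMBER AT `(w, P)`, Stage-8 construction, from (1.1), `HRestrict`, intermediate uniqueness and the orbit-point invariance of
`A_j ∘ Ū^j`, per step `k ≤ K`.** [cite: Balaban1987RG1, Thm 3 p.264, (0.21) p.256, (1.1) p.260, (2.16) p.269; Balaban1985Variational, Thm 1 (8)–(10) p.279] -/
theorem thm3Member_stage8_of_hRestrict
    (h11 : ∀ k, k ≤ P.K → ∀ V ∈ domAltOfRecord F N θ.ν P.K k, UkExists F N P.K k θ.εbg V ∧ UniqueUkOrbit F N P.K k θ.εbg V)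
    (hres : ∀ k, k ≤ P.K → HRestrict F N θ.εbg P.K k (domAltOfRecord F N θ.ν P.K k))
    (huniq : ∀ k, k ≤ P.K → ∀ V ∈ domAltOfRecord F N θ.ν P.K k, ∀ j < k,
      UniqueUkOrbit F N P.K (j + 1) θ.εbg (Averaging.iter (avOfRecord F N P.K) (j + 1) (Uk F N P.K k θ.εbg V)))
    (hinv : ∀ k, k ≤ P.K → ∀ V ∈ domAltOfRecord F N θ.ν P.K k, ∀ j < k, ∀ u : GaugeTransf (F.P P.K) 0 (SU N),
      B12GaugeOrbits021.IsResidual (j + 1) u →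
        effActionH F N (chi7 F N θ) P.K (genSeq (betaOfRecord₈ F N θ) P.g0) j
            (Averaging.iter (avOfRecord F N P.K) j (GaugeField.gaugeAct u (Uk F N P.K k θ.εbg V))) =
          effActionH F N (chi7 F N θ) P.K (genSeq (betaOfRecord₈ F N θ) P.g0) j
            (Averaging.iter (avOfRecord F N P.K) j (Uk F N P.K k θ.εbg V))) :
    (leavesP w P).smallCouplings → (leavesP w P).smallFieldInductive :=
  thm3Member_stage8_of_steps θ hC P fun k hk hflow =>
    indAss_stage8_of_hRestrict F N θ P k hflow (h11 k hk) (hres k hk) (huniq k hk) (hinv k hk)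

omit [NeZero N] in
/-- N09 at `(w, P)` from its own leaf `b12` and its Theorem-3 member (the in-edges `b4 … b11`, `b13` unused). [cite: Balaban1987RG1, Thm 1 p.259 and Thm 3 p.264 (bookkeeping)] -/
theorem b12_main_of_leaf_of_thm3Member {w : WorldP} {P : B12.RunParams} (h12 : (leavesP w P).b12)
    (hT : (leavesP w P).smallCouplings → (leavesP w P).smallFieldInductive) : Dag.B12_main (leavesP w P) :=
  fun _ _ _ _ _ _ _ _ => ⟨h12, fun _ _ => hT⟩

omit [NeZero N] in
/-- Given its Theorem-3 member, N09 at `(w, P)` IS «in-edges `b4 … b11` → its own leaf `b12`». [cite: Balaban1987RG1, Thm 1 p.259 and Lemma 4 p.280 (bookkeeping)] -/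
theorem b12_main_iff_leaf_of_thm3Member {w : WorldP} {P : B12.RunParams}
    (hT : (leavesP w P).smallCouplings → (leavesP w P).smallFieldInductive) :
    Dag.B12_main (leavesP w P) ↔
      ((leavesP w P).b4 → (leavesP w P).b5 → (leavesP w P).b6 → (leavesP w P).b7 → (leavesP w P).b8 → (leavesP w P).b9 →
        (leavesP w P).b10 → (leavesP w P).b11 → (leavesP w P).b12) :=
  ⟨fun h h4 h5 h6 h7 h8 h9 h10 h11 => (h h4 h5 h6 h7 h8 h9 h10 h11).1,
    fun h h4 h5 h6 h7 h8 h9 h10 h11 => ⟨h h4 h5 h6 h7 h8 h9 h10 h11, fun _ _ => hT⟩⟩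

include hC in
/-- **N09 AT `(w, P)`, Stage-8 construction, from the run's own leaf `b12` and the [B11]-side inputs (c)(d).**
[cite: Balaban1987RG1, Thm 1 p.259, Thm 3 p.264 and Lemma 4 (3.53) p.280] -/
theorem b12_main_stage8_of_leaf_of_hCompT (h12 : (leavesP w P).b12)
    (h11 : ∀ k, k ≤ P.K → ∀ V ∈ domAltOfRecord F N θ.ν P.K k, UkExists F N P.K k θ.εbg V ∧ UniqueUkOrbit F N P.K k θ.εbg V)
    (hcomp : ∀ k, k ≤ P.K → HCompT F N (TOfRecord F N) (chi7 F N θ) θ.εbg P.K (genSeq (betaOfRecord₈ F N θ) P.g0) k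
      (domAltOfRecord F N θ.ν P.K k)) :
    Dag.B12_main (leavesP w P) :=
  b12_main_of_leaf_of_thm3Member h12 (thm3Member_stage8_of_hCompT θ hC P h11 hcomp)

include hC in
/-- **N09 AT `(w, P)`, Stage-8 construction, IS «in-edges → its own leaf `b12`»** given the [B11]-side inputs (c)(d) at the run's objects.
[cite: Balaban1987RG1, Thm 1 p.259, Thm 3 p.264 and Lemma 4 (3.53) p.280] -/
theorem b12_main_stage8_iff_leaf_of_hCompT
    (h11 : ∀ k, k ≤ P.K → ∀ V ∈ domAltOfRecord F N θ.ν P.K k, UkExists F N P.K k θ.εbg V ∧ UniqueUkOrbit F N P.K k θ.εbg V)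
    (hcomp : ∀ k, k ≤ P.K → HCompT F N (TOfRecord F N) (chi7 F N θ) θ.εbg P.K (genSeq (betaOfRecord₈ F N θ) P.g0) k
      (domAltOfRecord F N θ.ν P.K k)) :
    Dag.B12_main (leavesP w P) ↔
      ((leavesP w P).b4 → (leavesP w P).b5 → (leavesP w P).b6 → (leavesP w P).b7 → (leavesP w P).b8 → (leavesP w P).b9 →
        (leavesP w P).b10 → (leavesP w P).b11 → (leavesP w P).b12) :=
  b12_main_iff_leaf_of_thm3Member (thm3Member_stage8_of_hCompT θ hC P h11 hcomp)

/-- **THE OWN LEAF AT A RUN BOUND BY THE C-BINDING OF RECORD** (`w.up P = upOfRecord₅C (θ.toStage5) P`): `(leavesP w P).b12` ↔ Lemma 4 (3.53) over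
the B12 group of the record's run-indexed carrier family `θ.res.X P` — the Stage-3 substitutions and the `b10` re-binding never touch the B12 group
(`Node00.upOfRecord₅C_leaves`, `B12NodeKnit.carriers₃_groupB12`; `Iff.rfl`). The family `Residual₅.X` is FREE at Stage 8: this leaf is the B12-group
pin NODE 00 owes. [cite: Balaban1987RG1, Lemma 4 (3.53) p.280 (the leaf's statement at the record; bookkeeping)] -/
theorem b12_leaf_stage8_iff (hup : w.up P = upOfRecord₅C F N (θ.toStage5 F N) P) :
    (leavesP w P).b12 ↔ B12Sec2to5.Lemma4Printed (θ.res.X P).F12 (θ.res.X P).c12 := by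
  show (w.up P).b12 ↔ _
  rw [hup]
  exact Iff.rfl

include hC in
/-- **§5 — THE DISCHARGE SHAPE UNDER THE B12-GROUP PIN (R422, θ explicit).**  If the record's parameter pins the run's B12 frame to the concrete
Lemma-4 frame of a package `D'` of the by-reference inputs of Lemma 4's proof (`(θ.res.X P).F12 = frameOf 𝓜 (θ.res.X P).c12 D'`), then N09 holds at
`(w, P)` from the [B11]-side inputs (c)(d): conjunct 1 by `B12NodeKnit.b12_leaf_of_frameOf` (Lemma 4 (3.53) p. 280 on the concrete frame,
`B12Lemma4ConcreteFrame.lemma4Printed_frameOf`), the Theorem-3 member by §3. [cite: Balaban1987RG1, Lemma 4 (3.53) p.280, Thm 1 p.259 and Thm 3 p.264] -/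
theorem b12_main_stage8_of_frameOf_of_hCompT (hup : w.up P = upOfRecord₅C F N (θ.toStage5 F N) P)
    {Q : Params} {i : ℕ} {𝔸 : Type} [NormedRing 𝔸] [NormedAlgebra ℂ 𝔸] [CompleteSpace 𝔸] [NormOneClass 𝔸] {𝓜 : Model 𝔸}
    (D' : Lemma4Data Q i 𝓜 (θ.res.X P).c12) (hF : (θ.res.X P).F12 = frameOf 𝓜 (θ.res.X P).c12 D')
    (h11 : ∀ k, k ≤ P.K → ∀ V ∈ domAltOfRecord F N θ.ν P.K k, UkExists F N P.K k θ.εbg V ∧ UniqueUkOrbit F N P.K k θ.εbg V)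
    (hcomp : ∀ k, k ≤ P.K → HCompT F N (TOfRecord F N) (chi7 F N θ) θ.εbg P.K (genSeq (betaOfRecord₈ F N θ) P.g0) k
      (domAltOfRecord F N θ.ν P.K k)) :
    Dag.B12_main (leavesP w P) := by
  refine b12_main_stage8_of_leaf_of_hCompT θ hC P ?_ h11 hcomp
  rw [b12_leaf_stage8_iff θ P hup]
  exact B12NodeKnit.b12_leaf_of_frameOf ((θ.toStage5 F N).res.Y P) ((θ.toStage5 F N).res.Z P) ((θ.toStage5 F N).res.V P)
    ((θ.toStage5 F N).res.W P) D' hF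

end Stage8

/-! ## §4. At the Stage-8 record predicate `IsRecordOfRecord₈C F N D w` (hypotheses over the record's parameters) -/

section Record

variable {F N}
variable {D : FiniteEpsData F (SU N)} {w : WorldP}

/-- **THE THEOREM-3 MEMBER OF N09 AT EVERY RUN OF A STAGE-8 RECORD, from (1.1) on the domains and `HCompT` over the record's parameters** (every
admissible `θ : Stage8Params F N` presenting `D` and binding `w`). Inputs (a) χ-locality and (b) (0.20) are theorems (§1); nothing else is used —
in particular neither `b12`, `b13` nor `b4 … b11`: at Stage 8 `IndAss` is the FORMAT clause (1.1) ∧ (1.3) of record (D-defB-2).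
[cite: Balaban1987RG1, Thm 1 p.259, Thm 3 p.264, (1.1)–(1.3) p.260 and (0.22)–(0.23) p.256] -/
theorem thm3Member_at_record₈C_of_hCompT (h : IsRecordOfRecord₈C F N D w)
    (h11 : ∀ θ : Stage8Params F N, θ.Admissible → D = datumOfRecord₅ F N (θ.toStage5 F N) → w.γ ≤ θ.γ →
      ∀ (p : B12.RunParams) (k : ℕ), k ≤ p.K →
        ∀ V ∈ domAltOfRecord F N θ.ν p.K k, UkExists F N p.K k θ.εbg V ∧ UniqueUkOrbit F N p.K k θ.εbg V)
    (hcomp : ∀ θ : Stage8Params F N, θ.Admissible → D = datumOfRecord₅ F N (θ.toStage5 F N) → w.γ ≤ θ.γ →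
      ∀ (p : B12.RunParams) (k : ℕ), k ≤ p.K →
        HCompT F N (TOfRecord F N) (chi7 F N θ) θ.εbg p.K (genSeq (betaOfRecord₈ F N θ) p.g0) k (domAltOfRecord F N θ.ν p.K k))
    (P : B12.RunParams) : (leavesP w P).smallCouplings → (leavesP w P).smallFieldInductive := by
  obtain ⟨θ, hθ, hD, hC, hγ, -, -⟩ := h
  have hC' : w.C = (datumOfRecord₅ F N (θ.toStage5 F N)).C := by rw [hC, hD]
  exact thm3Member_stage8_of_hCompT θ hC' P (fun k hk => h11 θ hθ hD hγ.2 P k hk) (fun k hk => hcomp θ hθ hD hγ.2 P k hk)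

/-- **THE THEOREM-3 MEMBER AT EVERY RUN OF A STAGE-8 RECORD, from (1.1), `HRestrict`, intermediate uniqueness and the orbit-point invariance of
`A_j ∘ Ū^j` over the record's parameters.** [cite: Balaban1987RG1, Thm 3 p.264, (0.21) p.256, (1.1) p.260, (2.16) p.269; Balaban1985Variational, Thm 1 (8)–(10) p.279] -/
theorem thm3Member_at_record₈C_of_hRestrict (h : IsRecordOfRecord₈C F N D w)
    (h11 : ∀ θ : Stage8Params F N, θ.Admissible → D = datumOfRecord₅ F N (θ.toStage5 F N) → w.γ ≤ θ.γ →
      ∀ (p : B12.RunParams) (k : ℕ), k ≤ p.K →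
        ∀ V ∈ domAltOfRecord F N θ.ν p.K k, UkExists F N p.K k θ.εbg V ∧ UniqueUkOrbit F N p.K k θ.εbg V)
    (hres : ∀ θ : Stage8Params F N, θ.Admissible → D = datumOfRecord₅ F N (θ.toStage5 F N) → w.γ ≤ θ.γ →
      ∀ (p : B12.RunParams) (k : ℕ), k ≤ p.K → HRestrict F N θ.εbg p.K k (domAltOfRecord F N θ.ν p.K k))
    (huniq : ∀ θ : Stage8Params F N, θ.Admissible → D = datumOfRecord₅ F N (θ.toStage5 F N) → w.γ ≤ θ.γ →
      ∀ (p : B12.RunParams) (k : ℕ), k ≤ p.K → ∀ V ∈ domAltOfRecord F N θ.ν p.K k, ∀ j < k,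
        UniqueUkOrbit F N p.K (j + 1) θ.εbg (Averaging.iter (avOfRecord F N p.K) (j + 1) (Uk F N p.K k θ.εbg V)))
    (hinv : ∀ θ : Stage8Params F N, θ.Admissible → D = datumOfRecord₅ F N (θ.toStage5 F N) → w.γ ≤ θ.γ →
      ∀ (p : B12.RunParams) (k : ℕ), k ≤ p.K → ∀ V ∈ domAltOfRecord F N θ.ν p.K k, ∀ j < k,
        ∀ u : GaugeTransf (F.P p.K) 0 (SU N), B12GaugeOrbits021.IsResidual (j + 1) u →
          effActionH F N (chi7 F N θ) p.K (genSeq (betaOfRecord₈ F N θ) p.g0) j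
              (Averaging.iter (avOfRecord F N p.K) j (GaugeField.gaugeAct u (Uk F N p.K k θ.εbg V))) =
            effActionH F N (chi7 F N θ) p.K (genSeq (betaOfRecord₈ F N θ) p.g0) j
              (Averaging.iter (avOfRecord F N p.K) j (Uk F N p.K k θ.εbg V)))
    (P : B12.RunParams) : (leavesP w P).smallCouplings → (leavesP w P).smallFieldInductive := by
  obtain ⟨θ, hθ, hD, hC, hγ, -, -⟩ := h
  have hC' : w.C = (datumOfRecord₅ F N (θ.toStage5 F N)).C := by rw [hC, hD]
  exact thm3Member_stage8_of_hRestrict θ hC' P (fun k hk => h11 θ hθ hD hγ.2 P k hk) (fun k hk => hres θ hθ hD hγ.2 P k hk)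
    (fun k hk => huniq θ hθ hD hγ.2 P k hk) (fun k hk => hinv θ hθ hD hγ.2 P k hk)

/-- **N09 AT A STAGE-8 RECORD IS ITS OWN LEAF.**  At every run of every Stage-8 record, GIVEN the [B11]-side inputs (c)(d) over the record's
parameters, `Dag.B12_main (leavesP w P)` ↔ «`b4 → b5 → b6 → b7 → b8 → b9 → b10 → b11 → b12`» — and `b12` is Lemma 4 (3.53) over the
record's FREE run-indexed B12 carriers (`b12_leaf_at_record₈C_iff`): the remaining obligation of N09 at the record is EXACTLY the B12-group pin.
[cite: Balaban1987RG1, Lemma 4 (3.53) p.280, Thm 1 p.259 and Thm 3 p.264] -/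
theorem b12_main_at_record₈C_iff_leaf (h : IsRecordOfRecord₈C F N D w)
    (h11 : ∀ θ : Stage8Params F N, θ.Admissible → D = datumOfRecord₅ F N (θ.toStage5 F N) → w.γ ≤ θ.γ →
      ∀ (p : B12.RunParams) (k : ℕ), k ≤ p.K →
        ∀ V ∈ domAltOfRecord F N θ.ν p.K k, UkExists F N p.K k θ.εbg V ∧ UniqueUkOrbit F N p.K k θ.εbg V)
    (hcomp : ∀ θ : Stage8Params F N, θ.Admissible → D = datumOfRecord₅ F N (θ.toStage5 F N) → w.γ ≤ θ.γ →
      ∀ (p : B12.RunParams) (k : ℕ), k ≤ p.K →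
        HCompT F N (TOfRecord F N) (chi7 F N θ) θ.εbg p.K (genSeq (betaOfRecord₈ F N θ) p.g0) k (domAltOfRecord F N θ.ν p.K k))
    (P : B12.RunParams) :
    Dag.B12_main (leavesP w P) ↔
      ((leavesP w P).b4 → (leavesP w P).b5 → (leavesP w P).b6 → (leavesP w P).b7 → (leavesP w P).b8 → (leavesP w P).b9 →
        (leavesP w P).b10 → (leavesP w P).b11 → (leavesP w P).b12) :=
  b12_main_iff_leaf_of_thm3Member (thm3Member_at_record₈C_of_hCompT h h11 hcomp P)

/-- **THE OWN LEAF AT A STAGE-8 RECORD, UNFOLDED**: for every parameter `θ` binding `w` (`w.up P = upOfRecord₅C (θ.toStage5) P`), `(leavesP w P).b12`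
↔ `B12Sec2to5.Lemma4Printed (θ.res.X P).F12 (θ.res.X P).c12` — Lemma 4 over the record's FREE run-indexed carrier family. [cite: Balaban1987RG1, Lemma 4 (3.53) p.280 (bookkeeping)] -/
theorem b12_leaf_at_record₈C_iff (h : IsRecordOfRecord₈C F N D w) (P : B12.RunParams) :
    ∃ θ : Stage8Params F N, θ.Admissible ∧ D = datumOfRecord₅ F N (θ.toStage5 F N) ∧ (∀ P', w.up P' = upOfRecord₅C F N (θ.toStage5 F N) P') ∧
      ((leavesP w P).b12 ↔ B12Sec2to5.Lemma4Printed (θ.res.X P).F12 (θ.res.X P).c12) := by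
  obtain ⟨θ, hθ, hD, -, -, -, hup⟩ := h
  exact ⟨θ, hθ, hD, hup, b12_leaf_stage8_iff θ P (hup P)⟩

/-- **N09 AT EVERY RUN OF A STAGE-8 RECORD from (c)(d) over the record's parameters and the own leaf `b12` at every run** — the form N24's knit
(`Node00.N24_at_record₈C`, binder `h09`) consumes; `hb12` is conjunct 1 over the record's free B12 carriers, i.e. the B12-group pin, displayed.
[cite: Balaban1987RG1, Lemma 4 (3.53) p.280, Thm 1 p.259 and Thm 3 p.264] -/
theorem b12_main_at_record₈C_of_leaf (h : IsRecordOfRecord₈C F N D w)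
    (hb12 : ∀ θ : Stage8Params F N, θ.Admissible → D = datumOfRecord₅ F N (θ.toStage5 F N) → w.γ ≤ θ.γ →
      (∀ P, w.up P = upOfRecord₅C F N (θ.toStage5 F N) P) → ∀ P, B12Sec2to5.Lemma4Printed (θ.res.X P).F12 (θ.res.X P).c12)
    (h11 : ∀ θ : Stage8Params F N, θ.Admissible → D = datumOfRecord₅ F N (θ.toStage5 F N) → w.γ ≤ θ.γ →
      ∀ (p : B12.RunParams) (k : ℕ), k ≤ p.K →
        ∀ V ∈ domAltOfRecord F N θ.ν p.K k, UkExists F N p.K k θ.εbg V ∧ UniqueUkOrbit F N p.K k θ.εbg V)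
    (hcomp : ∀ θ : Stage8Params F N, θ.Admissible → D = datumOfRecord₅ F N (θ.toStage5 F N) → w.γ ≤ θ.γ →
      ∀ (p : B12.RunParams) (k : ℕ), k ≤ p.K →
        HCompT F N (TOfRecord F N) (chi7 F N θ) θ.εbg p.K (genSeq (betaOfRecord₈ F N θ) p.g0) k (domAltOfRecord F N θ.ν p.K k))
    (P : B12.RunParams) : Dag.B12_main (leavesP w P) := by
  obtain ⟨θ, hθ, hD, hC, hγ, -, hup⟩ := id h
  have h12 : (leavesP w P).b12 := (b12_leaf_stage8_iff θ P (hup P)).2 (hb12 θ hθ hD hγ.2 hup P)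
  exact b12_main_of_leaf_of_thm3Member h12 (thm3Member_at_record₈C_of_hCompT h h11 hcomp P)

end Record

/-! ## §6. Which clauses of `HCompT` carry content; the first steps `k = 0, 1, 2` of the Theorem-3 member at the Stage-8 construction -/

section Clauses

variable {F N}

/-- **(1.1) AT LEVEL 0 IS MEMBERSHIP IN THE REGULARITY CLASS**: over a level-`0` configuration `V` the only configuration with `Ū⁰(U) = V`
is `U = V` (`Averaging.iter av 0 = id`), so the level-`0` problem is solvable iff `V ∈ U_0(ε)` — and then `U_0(V)` is a minimiser trivially.
[cite: Balaban1987RG1, (0.21) p.256 and (1.1)–(1.2) p.260 (the case k = 0; bookkeeping)] -/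
theorem ukExists_zero_iff {K : ℕ} {ε : ℝ} (V : GaugeField (F.P K) 0 (SU N)) :
    UkExists F N K 0 ε V ↔ V ∈ bgReg F N K 0 ε := by
  constructor
  · rintro ⟨U₀, hU₀⟩
    have h1 : U₀ = V := hU₀.1
    rw [← h1]
    exact hU₀.2.1
  · intro hV
    exact ⟨V, rfl, hV, fun U _ hUV => (congrArg wilsonAction4 (show U = V from hUV)).symm.le⟩

/-- **(1.1)-UNIQUENESS AT LEVEL 0 HOLDS OUTRIGHT**: two solutions over `V` at level `0` both equal `V`, and `1` is residual of every level
(`B12GaugeOrbits021.OrbitRel.refl`). [cite: Balaban1987RG1, (1.1) p.260 (the case k = 0; bookkeeping)] -/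
theorem uniqueUkOrbit_zero {K : ℕ} {ε : ℝ} (V : GaugeField (F.P K) 0 (SU N)) : UniqueUkOrbit F N K 0 ε V := by
  intro U₀ U₀' h h'
  have h1 : U₀ = V := h.1
  have h2 : U₀' = V := h'.1
  rw [h1, h2]
  exact B12GaugeOrbits021.OrbitRel.refl 0 V

variable (T : Transport F N) (χ : (K : ℕ) → (ℕ → ℝ) → (k : ℕ) → Density (F.P K) k (SU N)) {ε : ℝ} {K : ℕ} (g : ℕ → ℝ)

/-- **THE TOP CLAUSE OF `HCompT` IS AUTOMATIC** (any transport): for `j + 1 = k` the configuration `Ū^{j+1}(U_k V) = V` (`iter_Uk`), so both sides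
of the clause are `A_j(Ū^j(U_k V))`; hence `HCompT … k dom` follows from solvability at level `k` on `dom` and the clauses with `j + 1 < k`.
[cite: Balaban1987RG1, (0.23) p.256 and (1.1) p.260 (bookkeeping)] -/
theorem hCompT_of_lower {k : ℕ} {dom : Set (GaugeField (F.P K) k (SU N))} (hk : ∀ V ∈ dom, UkExists F N K k ε V)
    (hlow : ∀ V ∈ dom, ∀ j, j + 1 < k →
      effActionHT F N T χ K g j (Averaging.iter (avOfRecord F N K) j
          (Uk F N K (j + 1) ε (Averaging.iter (avOfRecord F N K) (j + 1) (Uk F N K k ε V)))) =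
        effActionHT F N T χ K g j (Averaging.iter (avOfRecord F N K) j (Uk F N K k ε V))) :
    HCompT F N T χ ε K g k dom := by
  intro V hV j hj
  rcases Nat.lt_or_ge (j + 1) k with hlt | hge
  · exact hlow V hV j hlt
  · have hjk : j + 1 = k := le_antisymm (Nat.succ_le_of_lt hj) hge
    subst hjk
    rw [iter_Uk (hk V hV)]

/-- **THE BOTTOM CLAUSE OF `HCompT` IS `HOrbit`'S BOTTOM CLAUSE** (any transport): `A_0 = −(1/g_0²) A^η` (`effActionHT_zero`) is constant on gauge orbits
(`B12GaugeOrbits021.wilsonAction4_eq_of_orbitRel`), so the `j = 0` clause holds as soon as `U_1(Ū(U_k V))` lies in the level-`1` residual orbit of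
`U_k V`. [cite: Balaban1987RG1, (0.17) p.255, (0.21) p.256 and (1.1) p.260] -/
theorem hCompT_clause_zero {k : ℕ} {V : GaugeField (F.P K) k (SU N)}
    (hO : B12GaugeOrbits021.OrbitRel 1 (Uk F N K k ε V)
      (Uk F N K 1 ε (Averaging.iter (avOfRecord F N K) 1 (Uk F N K k ε V)))) :
    effActionHT F N T χ K g 0 (Averaging.iter (avOfRecord F N K) 0
        (Uk F N K (0 + 1) ε (Averaging.iter (avOfRecord F N K) (0 + 1) (Uk F N K k ε V)))) =
      effActionHT F N T χ K g 0 (Averaging.iter (avOfRecord F N K) 0 (Uk F N K k ε V)) := by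
  show effActionHT F N T χ K g 0 (Uk F N K 1 ε (Averaging.iter (avOfRecord F N K) 1 (Uk F N K k ε V))) =
    effActionHT F N T χ K g 0 (Uk F N K k ε V)
  have h := B12GaugeOrbits021.wilsonAction4_eq_of_orbitRel hO
  unfold wilsonAction4 at h
  rw [effActionHT_zero, B12Eq019ActionBody.wilsonTerm_apply, B12Eq019ActionBody.wilsonTerm_apply, h]

/-- **`HCompT` FROM ITS MIDDLE CLAUSES**: solvability at level `k` on `dom` (top clause), `HOrbit`'s bottom clause when `k ≥ 2` (bottom clause), and
the clauses `1 ≤ j ≤ k − 2` — the only ones that read an invariance property of the EFFECTIVE actions `A_j`, `j ≥ 1`.  Kernel form of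
`Node00.BackgroundActionT`'s remark «for `k ≤ 2` no `HInvT` at a level `j ≥ 1` is needed». [cite: Balaban1987RG1, (0.23) p.256, (1.1) p.260 and (2.16) p.269] -/
theorem hCompT_of_middle {k : ℕ} {dom : Set (GaugeField (F.P K) k (SU N))} (hk : ∀ V ∈ dom, UkExists F N K k ε V)
    (hO0 : ∀ V ∈ dom, 1 < k → B12GaugeOrbits021.OrbitRel 1 (Uk F N K k ε V)
      (Uk F N K 1 ε (Averaging.iter (avOfRecord F N K) 1 (Uk F N K k ε V))))
    (hmid : ∀ V ∈ dom, ∀ j, 1 ≤ j → j + 1 < k →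
      effActionHT F N T χ K g j (Averaging.iter (avOfRecord F N K) j
          (Uk F N K (j + 1) ε (Averaging.iter (avOfRecord F N K) (j + 1) (Uk F N K k ε V)))) =
        effActionHT F N T χ K g j (Averaging.iter (avOfRecord F N K) j (Uk F N K k ε V))) :
    HCompT F N T χ ε K g k dom := by
  refine hCompT_of_lower T χ g hk fun V hV j hj1 => ?_
  rcases Nat.eq_zero_or_pos j with rfl | hpos
  · exact hCompT_clause_zero T χ g (hO0 V hV (by simpa using hj1))
  · exact hmid V hV j hpos hj1

/-- `HCompT` at `k = 0` is vacuous. [cite: Balaban1987RG1, (0.23) p.256 (the case k = 0; bookkeeping)] -/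
theorem hCompT_zero (dom : Set (GaugeField (F.P K) 0 (SU N))) : HCompT F N T χ ε K g 0 dom :=
  fun _ _ j hj => absurd hj (Nat.not_lt_zero j)

/-- `HCompT` at `k = 1` from solvability at level `1` (top clause only). [cite: Balaban1987RG1, (0.23) p.256 and (1.1) p.260 (the case k = 1)] -/
theorem hCompT_one {dom : Set (GaugeField (F.P K) 1 (SU N))} (h1 : ∀ V ∈ dom, UkExists F N K 1 ε V) :
    HCompT F N T χ ε K g 1 dom :=
  hCompT_of_lower T χ g h1 fun _ _ j hj => absurd hj (by omega)

/-- `HCompT` at `k = 2` from solvability at level `2` and `HOrbit`'s bottom clause (top + bottom clauses; no middle clause).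
[cite: Balaban1987RG1, (0.23) p.256 and (1.1) p.260 (the case k = 2)] -/
theorem hCompT_two {dom : Set (GaugeField (F.P K) 2 (SU N))} (h2 : ∀ V ∈ dom, UkExists F N K 2 ε V)
    (hO : ∀ V ∈ dom, B12GaugeOrbits021.OrbitRel 1 (Uk F N K 2 ε V)
      (Uk F N K 1 ε (Averaging.iter (avOfRecord F N K) 1 (Uk F N K 2 ε V)))) :
    HCompT F N T χ ε K g 2 dom :=
  hCompT_of_middle T χ g h2 (fun V hV _ => hO V hV) fun _ _ j hj1 hj2 => False.elim (by omega)

variable (F N)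

/-- **THE FIRST STEP OF THE THEOREM-3 MEMBER AT THE STAGE-8 CONSTRUCTION IS A THEOREM** modulo the numeric window `ε₀ ≤ ε` between the domain
threshold of record (`domAltOfRecord`: `|∂V − 1| < ε₀`, [I] p. 259) and the regularity radius of (1.2) at level `0` (`η_0 = 1`): `IndAss 0` holds at
every run — (1.1) at level 0 by `ukExists_zero_iff` ∕ `uniqueUkOrbit_zero`, (1.3) at `k = 0` with empty sums. (Print, p. 260: the assumptions are
formulated for `A_k`; at `k = 0`, `A_0 = −(1/g_0²)A`, (0.17).) [cite: Balaban1987RG1, (0.17) p.255, (1.1)–(1.3) p.260] -/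
theorem indAss_stage8_zero (θ : Stage8Params F N) (hε : θ.ν.ε₀ ≤ θ.εbg) (p : B12.RunParams) :
    ((datumOfRecord₅ F N (θ.toStage5 F N)).C p).IndAss 0 := by
  refine indAss_stage8_of_hCompT F N θ p 0 (fun j hj => absurd hj (Nat.not_lt_zero j))
    (fun V hV => ⟨?_, uniqueUkOrbit_zero V⟩) (hCompT_zero _ _ _ _)
  rw [ukExists_zero_iff, mem_bgReg_iff]
  rw [mem_domAltOfRecord_iff] at hV
  have heta : (F.P p.K).eta 0 = 1 := by simp [Params.eta]
  intro q
  calc dist1 (GaugeField.plaqHol V q) < θ.ν.ε₀ := hV q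
    _ ≤ θ.εbg * (F.P p.K).eta 0 ^ 2 := by rw [heta]; simpa using hε

/-- **THE SECOND STEP from (1.1) at level 1 on the domain and the flow recursion only** (`hCompT_one`): no invariance input.
[cite: Balaban1987RG1, (1.1)–(1.3) p.260 and (0.23) p.256 (the case k = 1)] -/
theorem indAss_stage8_one (θ : Stage8Params F N) (p : B12.RunParams)
    (hflow : RGEqH 1 (betaOfRecord₈ F N θ) (genSeq (betaOfRecord₈ F N θ) p.g0))
    (h11 : ∀ V ∈ domAltOfRecord F N θ.ν p.K 1, UkExists F N p.K 1 θ.εbg V ∧ UniqueUkOrbit F N p.K 1 θ.εbg V) :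
    ((datumOfRecord₅ F N (θ.toStage5 F N)).C p).IndAss 1 :=
  indAss_stage8_of_hCompT F N θ p 1 hflow h11 (hCompT_one _ _ _ fun V hV => (h11 V hV).1)

/-- **THE THIRD STEP from (1.1) at level 2, the flow recursion and `HOrbit`'s bottom clause at level 2** (⇐ `HRestrict` + (1.1)-uniqueness at
level 1, `Node00.hOrbit_of_hRestrict_of_unique`): no invariance of any effective action is read (`hCompT_two`).
[cite: Balaban1987RG1, (1.1)–(1.3) p.260, (0.21) and (0.23) p.256 (the case k = 2)] -/
theorem indAss_stage8_two (θ : Stage8Params F N) (p : B12.RunParams)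
    (hflow : RGEqH 2 (betaOfRecord₈ F N θ) (genSeq (betaOfRecord₈ F N θ) p.g0))
    (h11 : ∀ V ∈ domAltOfRecord F N θ.ν p.K 2, UkExists F N p.K 2 θ.εbg V ∧ UniqueUkOrbit F N p.K 2 θ.εbg V)
    (hO : ∀ V ∈ domAltOfRecord F N θ.ν p.K 2, B12GaugeOrbits021.OrbitRel 1 (Uk F N p.K 2 θ.εbg V)
      (Uk F N p.K 1 θ.εbg (Averaging.iter (avOfRecord F N p.K) 1 (Uk F N p.K 2 θ.εbg V)))) :
    ((datumOfRecord₅ F N (θ.toStage5 F N)).C p).IndAss 2 :=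
  indAss_stage8_of_hCompT F N θ p 2 hflow h11 (hCompT_two _ _ _ (fun V hV => (h11 V hV).1) hO)

variable {F N}
variable (θ : Stage8Params F N) {w : WorldP} (hC : w.C = (datumOfRecord₅ F N (θ.toStage5 F N)).C) (P : B12.RunParams)

include hC in
/-- **THE THEOREM-3 MEMBER AT `(w, P)`, Stage-8 construction, WITH THE INVARIANCE INPUT REDUCED TO THE MIDDLE CLAUSES**: (1.1) on the domains at every
level `k ≤ K`, `HOrbit`'s bottom clause at the levels `2 ≤ k ≤ K`, and — the only place an invariance property of the effective actions `A_j` (`j ≥ 1`)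
enters — the composition clauses `1 ≤ j ≤ k − 2`; the flow recursion is derived (§1), the top and bottom clauses are theorems (this §).
[cite: Balaban1987RG1, Thm 3 p.264, (0.21)–(0.23) p.256, (1.1)–(1.3) p.260 and (2.16) p.269] -/
theorem thm3Member_stage8_of_middle
    (h11 : ∀ k, k ≤ P.K → ∀ V ∈ domAltOfRecord F N θ.ν P.K k, UkExists F N P.K k θ.εbg V ∧ UniqueUkOrbit F N P.K k θ.εbg V)
    (hO0 : ∀ k, k ≤ P.K → 1 < k → ∀ V ∈ domAltOfRecord F N θ.ν P.K k,
      B12GaugeOrbits021.OrbitRel 1 (Uk F N P.K k θ.εbg V)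
        (Uk F N P.K 1 θ.εbg (Averaging.iter (avOfRecord F N P.K) 1 (Uk F N P.K k θ.εbg V))))
    (hmid : ∀ k, k ≤ P.K → ∀ V ∈ domAltOfRecord F N θ.ν P.K k, ∀ j, 1 ≤ j → j + 1 < k →
      effActionH F N (chi7 F N θ) P.K (genSeq (betaOfRecord₈ F N θ) P.g0) j
          (Averaging.iter (avOfRecord F N P.K) j
            (Uk F N P.K (j + 1) θ.εbg (Averaging.iter (avOfRecord F N P.K) (j + 1) (Uk F N P.K k θ.εbg V)))) =
        effActionH F N (chi7 F N θ) P.K (genSeq (betaOfRecord₈ F N θ) P.g0) j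
          (Averaging.iter (avOfRecord F N P.K) j (Uk F N P.K k θ.εbg V))) :
    (leavesP w P).smallCouplings → (leavesP w P).smallFieldInductive :=
  thm3Member_stage8_of_hCompT θ hC P h11 fun k hk =>
    hCompT_of_middle (TOfRecord F N) (chi7 F N θ) (genSeq (betaOfRecord₈ F N θ) P.g0) (fun V hV => (h11 k hk V hV).1)
      (fun V hV h1k => hO0 k hk h1k V hV) (fun V hV j hj1 hj2 => hmid k hk V hV j hj1 hj2)

end Clauses

/-! ## §7 (v1.1, append-only). Runs with at most two steps (`K ≤ 2`): the Theorem-3 member at the Stage-8 construction ∕ record from (1.1) at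
levels 1, 2, `HOrbit`'s bottom clause at level 2 and the level-0 window `ε₀ ≤ ε` — NO composition clause, NO invariance input -/

section ShortRuns

variable {F N}
variable (θ : Stage8Params F N) {w : WorldP} (hC : w.C = (datumOfRecord₅ F N (θ.toStage5 F N)).C) (P : B12.RunParams)

include hC in
/-- **THE THEOREM-3 MEMBER ON RUNS WITH `K ≤ 2`, Stage-8 construction**: `smallCouplings → smallFieldInductive` from the level-0 window `θ.ν.ε₀ ≤ θ.εbg`
(`indAss_stage8_zero`), (1.1) on the domains at levels `1 ≤ k ≤ K` and — if `K = 2` — `HOrbit`'s bottom clause at level 2 (`indAss_stage8_one ∕ _two`);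
the flow recursion is derived.  For such runs N09's Theorem-3 member at Stage 8 reads [B11] Thm 1 at the record's objects and nothing else.
[cite: Balaban1987RG1, Thm 3 p.264, (1.1)–(1.3) p.260 and (0.21)–(0.23) p.256 (the cases K ≤ 2)] -/
theorem thm3Member_stage8_of_K_le_two (hK : P.K ≤ 2) (hε : θ.ν.ε₀ ≤ θ.εbg)
    (h11 : ∀ k, 1 ≤ k → k ≤ P.K → ∀ V ∈ domAltOfRecord F N θ.ν P.K k,
      UkExists F N P.K k θ.εbg V ∧ UniqueUkOrbit F N P.K k θ.εbg V)
    (hO2 : 2 ≤ P.K → ∀ V ∈ domAltOfRecord F N θ.ν P.K 2, B12GaugeOrbits021.OrbitRel 1 (Uk F N P.K 2 θ.εbg V)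
      (Uk F N P.K 1 θ.εbg (Averaging.iter (avOfRecord F N P.K) 1 (Uk F N P.K 2 θ.εbg V)))) :
    (leavesP w P).smallCouplings → (leavesP w P).smallFieldInductive :=
  thm3Member_stage8_of_steps θ hC P fun k hk hflow =>
    match k, hk, hflow with
    | 0, _, _ => indAss_stage8_zero F N θ hε P
    | 1, hk, hflow => indAss_stage8_one F N θ P hflow (h11 1 le_rfl hk)
    | 2, hk, hflow => indAss_stage8_two F N θ P hflow (h11 2 (by norm_num) hk) (hO2 hk)
    | k + 3, hk, _ => absurd (hk.trans hK) (by omega)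

variable {D : FiniteEpsData F (SU N)}

/-- **THE THEOREM-3 MEMBER ON RUNS WITH `K ≤ 2` AT A STAGE-8 RECORD**, binders over the record's parameters: the level-0 window, (1.1) at levels
`1 ≤ k ≤ K`, `HOrbit`'s bottom clause at level 2. [cite: Balaban1987RG1, Thm 3 p.264, (1.1)–(1.3) p.260 and (0.21)–(0.23) p.256 (the cases K ≤ 2)] -/
theorem thm3Member_at_record₈C_of_K_le_two (h : IsRecordOfRecord₈C F N D w) (hK : P.K ≤ 2)
    (hε : ∀ θ : Stage8Params F N, θ.Admissible → D = datumOfRecord₅ F N (θ.toStage5 F N) → w.γ ≤ θ.γ → θ.ν.ε₀ ≤ θ.εbg)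
    (h11 : ∀ θ : Stage8Params F N, θ.Admissible → D = datumOfRecord₅ F N (θ.toStage5 F N) → w.γ ≤ θ.γ →
      ∀ k, 1 ≤ k → k ≤ P.K → ∀ V ∈ domAltOfRecord F N θ.ν P.K k, UkExists F N P.K k θ.εbg V ∧ UniqueUkOrbit F N P.K k θ.εbg V)
    (hO2 : ∀ θ : Stage8Params F N, θ.Admissible → D = datumOfRecord₅ F N (θ.toStage5 F N) → w.γ ≤ θ.γ → 2 ≤ P.K →
      ∀ V ∈ domAltOfRecord F N θ.ν P.K 2, B12GaugeOrbits021.OrbitRel 1 (Uk F N P.K 2 θ.εbg V)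
        (Uk F N P.K 1 θ.εbg (Averaging.iter (avOfRecord F N P.K) 1 (Uk F N P.K 2 θ.εbg V)))) :
    (leavesP w P).smallCouplings → (leavesP w P).smallFieldInductive := by
  obtain ⟨θ, hθ, hD, hC, hγ, -, -⟩ := h
  have hC' : w.C = (datumOfRecord₅ F N (θ.toStage5 F N)).C := by rw [hC, hD]
  exact thm3Member_stage8_of_K_le_two θ hC' P hK (hε θ hθ hD hγ.2) (h11 θ hθ hD hγ.2) (hO2 θ hθ hD hγ.2)

end ShortRuns

end Literature.MathematicalPhysics.QuantumFieldTheory.Balaban1983to89.B12NodeKnitRecord8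

end
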